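import Literature.NumberTheory.LFunctions.PrimeNumberTheoremErrorTerm
import Literature.NumberTheory.LFunctions.ClassicalPsiErrorTerm
import Literature.NumberTheory.LFunctions.ZetaZeroFreeRegion
import HarnessLib

/-!
# The prime number theorem with the de la Vallée Poussin error term (proofs)

Topic `Literature/NumberTheory/LFunctions`. Everything in this file is PROVED. It discharges the
two named facts of `PrimeNumberTheoremErrorTerm.lean` (Montgomery–Vaughan, *Multiplicative
Number Theory I*, Theorem 6.9, (6.12)–(6.13)):

* `ChebyshevPsiDeLaValleePoussin_holds : ChebyshevPsiDeLaValleePoussin` — `ψ(x) = x +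
  O(x exp(−c√log x))`, from the abstract de la Vallée-Poussin–Landau argument
  `Literature.NumberTheory.LFunctions.ClassicalZFRData.abs_psi_sub_le` (`ClassicalPsiErrorTerm.lean`: Perron's formula of order
  one, contour shift into the classical zero-free region, de-smoothing) applied to
  `Literature.NumberTheory.LFunctions.classicalZFRData_riemannZeta` (`ZetaZeroFreeRegion.lean`: `ζ` satisfies its
  hypotheses);
* `ChebyshevThetaDeLaValleePoussin_holds : ChebyshevThetaDeLaValleePoussin` — the `ϑ`-form
  (6.13), from the `ψ`-form and Mathlib's `|ψ(x) − ϑ(x)| ≤ 2 √x log x`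
  (`Chebyshev.abs_psi_sub_theta_le_sqrt_mul_log`), using `√x log x ≤ 4 e^{c²} x e^{−c√log x}`.

## References

* H. L. Montgomery, R. C. Vaughan, *Multiplicative Number Theory I. Classical Theory*, CUP 2007,
  Theorem 6.9, (6.12)–(6.13) (`MontgomeryVaughan2007`).
-/

open Real Finset

namespace Literature.NumberTheory.LFunctions

/-- **Montgomery–Vaughan Theorem 6.9, (6.12)** (de la Vallée Poussin 1899): PROVED —
`|ψ(x) − x| ≤ C x / exp(c √log x)` for `x ≥ 2`, with some absolute `c > 0`, `C`.
[cite: MontgomeryVaughan2007, Theorem 6.9 (6.12)] -/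
theorem ChebyshevPsiDeLaValleePoussin_holds : ChebyshevPsiDeLaValleePoussin := by
  obtain ⟨c, hc, C, h⟩ := Literature.NumberTheory.LFunctions.classicalZFRData_riemannZeta.abs_psi_sub_le
  refine ⟨c, hc, C, fun x hx ↦ ?_⟩
  have h1 := h x hx
  rw [Chebyshev.psi]
  calc _ ≤ C * x * Real.exp (-c * Real.sqrt (Real.log x)) := h1
    _ = C * x / Real.exp (c * Real.sqrt (Real.log x)) := by
        rw [neg_mul, Real.exp_neg, div_eq_mul_inv]

/-- `√x · log x ≤ 4 e^{c²} · x · e^{−c √log x}` for `x ≥ 1` and real `c`: with `L = log x`,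
`c√L ≤ L/4 + c²` and `L ≤ 4 e^{L/4}`. [folklore] -/
theorem sqrt_mul_log_le (c : ℝ) {x : ℝ} (hx : 1 ≤ x) :
    Real.sqrt x * Real.log x ≤
      4 * Real.exp (c ^ 2) * x * Real.exp (-c * Real.sqrt (Real.log x)) := by
  set L := Real.log x with hL
  have hL0 : 0 ≤ L := Real.log_nonneg hx
  have hx0 : 0 < x := by linarith
  set u := Real.sqrt L with hu
  have hu0 : 0 ≤ u := Real.sqrt_nonneg _
  have huL : u ^ 2 = L := Real.sq_sqrt hL0
  -- `c u ≤ L/4 + c²`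
  have h1 : c * u ≤ L / 4 + c ^ 2 := by nlinarith [sq_nonneg (u / 2 - c)]
  -- `L ≤ 4 exp(L/4)` since `exp(y) ≥ 1 + y`
  have h2 : L ≤ 4 * Real.exp (L / 4) := by
    have := Real.add_one_le_exp (L / 4)
    linarith
  -- `√x = exp(L/2)`, `x = exp L`
  have hsx : Real.sqrt x = Real.exp (L / 2) := by
    rw [hL, show Real.log x / 2 = Real.log x * (1 / 2) by ring, Real.exp_mul, Real.exp_log hx0,
      Real.sqrt_eq_rpow]
  have hxL : x = Real.exp L := by rw [hL, Real.exp_log hx0]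
  rw [hsx]
  conv_rhs => rw [hxL]
  -- compare `exp(L/2) · L` with `4 e^{c²} e^{L} e^{−c u}`
  have h3 : Real.exp (L / 2) * L ≤ Real.exp (L / 2) * (4 * Real.exp (L / 4)) :=
    mul_le_mul_of_nonneg_left h2 (Real.exp_pos _).le
  have h4 : Real.exp (L / 2) * (4 * Real.exp (L / 4)) = 4 * Real.exp (3 * L / 4) := by
    rw [mul_left_comm, ← Real.exp_add]; ring_nf
  have h5 : Real.exp (3 * L / 4) ≤ Real.exp (c ^ 2) * Real.exp L * Real.exp (-c * u) := by
    rw [← Real.exp_add, ← Real.exp_add, Real.exp_le_exp]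
    linarith
  calc Real.exp (L / 2) * L ≤ 4 * Real.exp (3 * L / 4) := by rw [← h4]; exact h3
    _ ≤ 4 * (Real.exp (c ^ 2) * Real.exp L * Real.exp (-c * u)) := by linarith
    _ = 4 * Real.exp (c ^ 2) * Real.exp L * Real.exp (-c * u) := by ring

/-- **Montgomery–Vaughan Theorem 6.9, (6.13)**: PROVED — `|ϑ(x) − x| ≤ C x / exp(c √log x)` for
`x ≥ 2`, from (6.12) and `|ψ − ϑ| ≤ 2√x log x`. [cite: MontgomeryVaughan2007, Theorem 6.9 (6.13)] -/
theorem ChebyshevThetaDeLaValleePoussin_holds : ChebyshevThetaDeLaValleePoussin := by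
  obtain ⟨c, hc, C, h⟩ := Literature.NumberTheory.LFunctions.classicalZFRData_riemannZeta.abs_psi_sub_le
  refine ⟨c, hc, C + 8 * Real.exp (c ^ 2), fun x hx ↦ ?_⟩
  have hx1 : 1 ≤ x := by linarith
  have hx0 : 0 < x := by linarith
  have h1 : |Chebyshev.psi x - x| ≤ C * x * Real.exp (-c * Real.sqrt (Real.log x)) := by
    rw [Chebyshev.psi]; exact h x hx
  have h2 := Chebyshev.abs_psi_sub_theta_le_sqrt_mul_log hx1
  have h3 := sqrt_mul_log_le c hx1
  have hE : Real.exp (-c * Real.sqrt (Real.log x)) = 1 / Real.exp (c * Real.sqrt (Real.log x)) := by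
    rw [neg_mul, Real.exp_neg, one_div]
  have htri : |Chebyshev.theta x - x| ≤ |Chebyshev.psi x - x| + |Chebyshev.psi x - Chebyshev.theta x| := by
    have := abs_sub_le (Chebyshev.theta x) (Chebyshev.psi x) x
    rwa [abs_sub_comm (Chebyshev.theta x) (Chebyshev.psi x), add_comm] at this
  calc |Chebyshev.theta x - x|
      ≤ C * x * Real.exp (-c * Real.sqrt (Real.log x)) +
          2 * (4 * Real.exp (c ^ 2) * x * Real.exp (-c * Real.sqrt (Real.log x))) := by
        refine htri.trans (add_le_add h1 (h2.trans ?_))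
        nlinarith [h3]
    _ = (C + 8 * Real.exp (c ^ 2)) * x / Real.exp (c * Real.sqrt (Real.log x)) := by
        rw [hE]; ring

end Literature.NumberTheory.LFunctions
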